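import Summits.AtomisticToContinuum.BoseEinsteinCondensation.Theses.BECLaplacianL1
import Summits.AtomisticToContinuum.BoseEinsteinCondensation.Theorems.BECLaplacianL1ModeCountingL1IRBound
import Summits.AtomisticToContinuum.BoseEinsteinCondensation.Theorems.BECGroundStateSOSIRModeCounting
import HarnessLib

/-!
# Route BECLaplacianL1, support item `ModeCountingL1` (stmt-AtomisticToContinuum-9012)

Closes `Summit.AtomisticToContinuum.BoseEinsteinCondensation.Theses.BECLaplacianL1.ModeCountingL1`
(`[KineticCoherenceL1 body for v] → [DiluteEnergyBound body for v] → [PeriodicBEC body for v]`,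
bodies inlined): for near-minimisers of the periodic `N`-body energy on the torus of side
`L_N = (N/ρ)^{1/3}`, smallness of the `L¹(cell)` norm of the kinetic coherence
`G_Ψ(r) = ∑ᵢ ∑ₖ ∫ ∂_{i,k}Ψ(X + r eᵢ) conj ∂_{i,k}Ψ(X) dX` (`≤ ε N ρ^{-1/3}` for every `ε`) together
with the crude energy bound `E₀^per ≤ C ρ^{2/3} N` implies condensation `⟨Ψ, n₀Ψ⟩ ≥ N/2` of the
same near-minimisers at all small densities. Proof (the item's sketch, architecture of
[KLS1988PRL] as in `BECGroundStateSOSIRModeCounting.lean`, here with an EXPONENT-2 infrared bound):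

* the infrared bound `L³|2πk/L|² n_k ≤ ‖G_Ψ‖₁` (`ir_bound_of_kineticCoherence`, helper file
  `BECLaplacianL1ModeCountingL1IRBound.lean`), i.e. `n_k ≤ εN/(4π² ρ^{1/3} L ‖k‖_∞²)`;
* Parseval in the traced variable `∑_k n_k = N` and for the gradient `∑_k |2πk/L|² n_k ≤ ⟨Ψ,HΨ⟩`
  (tree: `PeriodicBoseGasFracEnergy`), so with `κ² = (C+1)/π²` and slack `δ ≤ ρ^{2/3}N` the
  ultraviolet tail `‖k‖_∞ > κρ^{1/3}L` carries `≤ (E₀ + δ)/(4π²κ²ρ^{2/3}) ≤ N/4` particles;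
* the exponent-2 shell sum `∑_{0<‖k‖_∞≤M} 1/‖k‖_∞² ≤ 26 M` (shells of the cubes `{-M,…,M}³` of
  `BECGroundStateSOSIRModeCounting.lean`; this LINEAR growth is the `d = 3` lattice fact
  `∑_{0<|q|≤K}|q|⁻² ~ KL³`), whence the infrared window carries `≤ 26 εκN/(4π²) = N/4` particles for
  `ε = π²/(26κ)`;
* hence `n₀ ≥ N − N/4 − N/4 = N/2` (`condensate_ge_half_sq`, the counting step in abstract form).

## References

* [LSSY2005] E. H. Lieb, R. Seiringer, J. P. Solovej, J. Yngvason, *The Mathematics of the Bose Gas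
  and its Condensation*, Birkhäuser 2005, §1.2 (1.17)–(1.19) (one-particle density matrix, mode
  occupations, `tr γ = N`).
* [KLS1988PRL] T. Kennedy, E. H. Lieb, B. S. Shastry, Phys. Rev. Lett. 61 (1988) 2582 (infrared
  bound ⇒ long-range order by mode counting in `d = 3`).
-/

noncomputable section

open MeasureTheory Filter Complex
open scoped ENNReal NNReal ComplexConjugate

namespace Summit.AtomisticToContinuum.BoseEinsteinCondensation.Theorems

namespace LaplacianModeCounting

open Literature.MathematicalPhysics.QuantumManyBody.BoseGas

/-! ## §5 Lattice bookkeeping: the exponent-2 shell sum on the cubes `{-M,…,M}³` -/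

open ModeCounting

/-- **The exponent-2 shell sum** `∑_{0 < ‖k‖_∞ ≤ M} 1/‖k‖_∞² ≤ 26 M` on `ℤ³` (the shell `‖k‖_∞ = m`
has `(2m+1)³ − (2m−1)³ = 24m² + 2 ≤ 26m²` points; induction on `M`). This linear growth in `M` is
the `d = 3` lattice fact `∑_{0<|q|≤K} |q|⁻² ~ K L³` behind mode counting from an exponent-2 infrared
bound.
[cite: KLS1988PRL] -/
theorem sum_inv_norm_sq_latticeShell_le (M : ℕ) :
    ∑ k ∈ ((Fintype.piFinset fun _ : Fin 3 => Finset.Icc (-((M : ℕ) : ℤ)) ((M : ℕ) : ℤ))).erase 0,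
      1 / ‖(fun i => (k i : ℝ))‖ ^ 2 ≤ 26 * (M : ℝ) := by
  classical
  induction M with
  | zero =>
    rw [Finset.sum_eq_zero fun k hk => ?_]
    · simp
    · rw [Finset.mem_erase] at hk
      exact absurd (eq_zero_of_mem_latticeBox_zero hk.2) hk.1
  | succ M ih =>
    set s : Finset (Fin 3 → ℤ) := ((Fintype.piFinset fun _ : Fin 3 =>
      Finset.Icc (-((M : ℕ) : ℤ)) ((M : ℕ) : ℤ))).erase 0 with hs
    set t : Finset (Fin 3 → ℤ) := ((Fintype.piFinset fun _ : Fin 3 =>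
      Finset.Icc (-((M + 1 : ℕ) : ℤ)) ((M + 1 : ℕ) : ℤ))).erase 0 with ht
    have hsub : s ⊆ t := Finset.erase_subset_erase 0 (latticeBox_mono (Nat.le_succ M))
    rw [← Finset.sum_sdiff hsub]
    -- the new shell: each term is `≤ 1/(M+1)²` and there are `(2M+3)³ - (2M+1)³` of them
    have hterm : ∀ k ∈ t \ s, 1 / ‖(fun i => (k i : ℝ))‖ ^ 2 ≤ 1 / ((M : ℝ) + 1) ^ 2 := by
      intro k hk
      have hk' :
          k ∉ (Fintype.piFinset fun _ : Fin 3 => Finset.Icc (-((M : ℕ) : ℤ)) ((M : ℕ) : ℤ)) := by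
        simp only [Finset.mem_sdiff, ht, hs, Finset.mem_erase] at hk
        exact fun h => hk.2 ⟨hk.1.1, h⟩
      have h1 := succ_le_norm_of_not_mem_latticeBox hk'
      exact one_div_le_one_div_of_le (by positivity) (by gcongr)
    have hcard : (((t \ s).card : ℕ) : ℝ) = (2 * (M + 1) + 1) ^ 3 - (2 * M + 1) ^ 3 := by
      have h1 := Finset.card_sdiff_add_card_eq_card hsub
      have h2 : s.card + 1 = (2 * M + 1) ^ 3 := by
        rw [hs, Finset.card_erase_add_one (zero_mem_latticeBox M), card_latticeBox]
      have h3 : t.card + 1 = (2 * (M + 1) + 1) ^ 3 := by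
        rw [ht, Finset.card_erase_add_one (zero_mem_latticeBox (M + 1)), card_latticeBox]
      have h4 : (t \ s).card + (2 * M + 1) ^ 3 = (2 * (M + 1) + 1) ^ 3 := by omega
      have h5 : (((t \ s).card : ℕ) : ℝ) + (2 * M + 1) ^ 3 = (2 * (M + 1) + 1) ^ 3 := by
        exact_mod_cast h4
      linarith
    have hshell : ∑ k ∈ t \ s, 1 / ‖(fun i => (k i : ℝ))‖ ^ 2 ≤ 26 := by
      calc ∑ k ∈ t \ s, 1 / ‖(fun i => (k i : ℝ))‖ ^ 2 ≤ ∑ _k ∈ t \ s, 1 / ((M : ℝ) + 1) ^ 2 :=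
            Finset.sum_le_sum hterm
        _ = ((2 * (M + 1) + 1) ^ 3 - (2 * M + 1) ^ 3) * (1 / ((M : ℝ) + 1) ^ 2) := by
            rw [Finset.sum_const, nsmul_eq_mul, hcard]
        _ = (24 * (M : ℝ) ^ 2 + 48 * M + 26) / ((M : ℝ) + 1) ^ 2 := by ring
        _ ≤ 26 := by
            rw [div_le_iff₀ (by positivity)]
            nlinarith [sq_nonneg (M : ℝ), (Nat.cast_nonneg M : (0 : ℝ) ≤ M)]
    push_cast
    nlinarith [hshell, ih]

/-! ## §6 The counting step in abstract form (exponent 2) -/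

/-- **Mode counting on the torus from an exponent-2 infrared bound (abstract form).** Let `Ψ` be a
periodic `N`-body state on the torus of side `L`, `n_k = ⟨φ_k, γ_Ψ φ_k⟩` its plane-wave occupations.
Suppose (IR) `n_k ≤ C_ir/‖k‖_∞²` for `0 < ‖k‖_∞ ≤ K`; (UV) `D ≤ |2πk/L|²` for `‖k‖_∞ > K`, with
`D⁻¹⟨Ψ,HΨ⟩ ≤ N/4`; (window) `26 C_ir K ≤ N/4`. Then `⟨Ψ, n₀Ψ⟩ ≥ N/2`, since by Parseval
`N = ∑_k n_k ≤ n₀ + ∑_{IR} C_ir/‖k‖_∞² + D⁻¹∑_k|2πk/L|²n_k ≤ n₀ + 26 C_ir K + D⁻¹⟨Ψ,HΨ⟩`.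
[cite: LSSY2005, §1.2 (1.17)–(1.19)] -/
theorem condensate_ge_half_sq {N : ℕ} {L K Cir : ℝ} (hL : 0 < L) (hK : 0 ≤ K) (hCir : 0 ≤ Cir)
    (v : ℝ → ℝ≥0∞) (Ψ : PeriodicTrialState N L) {D : ℝ≥0∞} (hD0 : D ≠ 0) (hDtop : D ≠ ⊤)
    (hIR : ∀ k : Fin 3 → ℤ, k ≠ 0 → ‖(fun i => (k i : ℝ))‖ ≤ K →
      cellOccupation N L (planeWaveMode L k) Ψ.ψ ≤
        ENNReal.ofReal (Cir / ‖(fun i => (k i : ℝ))‖ ^ 2))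
    (hUV : ∀ k : Fin 3 → ℤ, K < ‖(fun i => (k i : ℝ))‖ → D ≤ fracDispersion 2 L k)
    (hT : D⁻¹ * periodicEnergy v Ψ ≤ ENNReal.ofReal (N / 4))
    (hW : Cir * (26 * K) ≤ N / 4) :
    ENNReal.ofReal (1 / 2 * N) ≤ condensateOccupation N L Ψ.ψ := by
  classical
  set n : (Fin 3 → ℤ) → ℝ≥0∞ := fun k => cellOccupation N L (planeWaveMode L k) Ψ.ψ with hn
  set M : ℕ := ⌊K⌋₊ with hM
  set S : Finset (Fin 3 → ℤ) :=
    ((Fintype.piFinset fun _ : Fin 3 => Finset.Icc (-((M : ℕ) : ℤ)) ((M : ℕ) : ℤ))).erase 0 with hS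
  -- pointwise three-way bound: zero mode / infrared window / ultraviolet tail
  have hpt : ∀ k, n k ≤ (if k = 0 then n k else 0) +
      (if k ∈ S then ENNReal.ofReal (Cir / ‖(fun i => (k i : ℝ))‖ ^ 2) else 0) +
        D⁻¹ * (fracDispersion 2 L k * n k) := by
    intro k
    by_cases hk0 : k = 0
    · rw [if_pos hk0]
      exact le_add_right (le_add_right le_rfl)
    · by_cases hkK : ‖(fun i => (k i : ℝ))‖ ≤ K
      · have hkS : k ∈ S := Finset.mem_erase.2 ⟨hk0, mem_latticeBox_floor_of_norm_le hkK⟩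
        rw [if_neg hk0, if_pos hkS, zero_add]
        exact le_add_right (hIR k hk0 hkK)
      · push Not at hkK
        refine le_add_left ?_
        calc n k = D⁻¹ * D * n k := by rw [ENNReal.inv_mul_cancel hD0 hDtop, one_mul]
          _ ≤ D⁻¹ * fracDispersion 2 L k * n k := by gcongr; exact hUV k hkK
          _ = D⁻¹ * (fracDispersion 2 L k * n k) := mul_assoc _ _ _
  -- the infrared window carries at most `N/4`
  have hIRsum :
      ∑ k ∈ S, ENNReal.ofReal (Cir / ‖(fun i => (k i : ℝ))‖ ^ 2) ≤ ENNReal.ofReal (N / 4) := by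
    rw [← ENNReal.ofReal_sum_of_nonneg (fun k _ => by positivity)]
    refine ENNReal.ofReal_le_ofReal ?_
    calc ∑ k ∈ S, Cir / ‖(fun i => (k i : ℝ))‖ ^ 2
        = Cir * ∑ k ∈ S, 1 / ‖(fun i => (k i : ℝ))‖ ^ 2 := by
          rw [Finset.mul_sum]
          exact Finset.sum_congr rfl fun k _ => (mul_one_div _ _).symm
      _ ≤ Cir * (26 * (M : ℝ)) := by gcongr; exact sum_inv_norm_sq_latticeShell_le M
      _ ≤ Cir * (26 * K) := by gcongr; exact Nat.floor_le hK
      _ ≤ N / 4 := hW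
  -- the ultraviolet tail carries at most `N/4`
  have hTsum : D⁻¹ * ∑' k, fracDispersion 2 L k * n k ≤ ENNReal.ofReal (N / 4) := by
    refine le_trans ?_ hT
    gcongr
    calc ∑' k, fracDispersion 2 L k * n k = ∫⁻ X in cellN N L, kineticDensity Ψ.ψ X :=
          tsum_fracDispersion_two_mul_cellOccupation hL Ψ
      _ ≤ periodicEnergy v Ψ := lintegral_mono fun X => le_self_add
  -- Parseval and summation of the pointwise bound
  have hS' : ∑ k ∈ S, (if k ∈ S then ENNReal.ofReal (Cir / ‖(fun i => (k i : ℝ))‖ ^ 2) else 0) =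
      ∑ k ∈ S, ENNReal.ofReal (Cir / ‖(fun i => (k i : ℝ))‖ ^ 2) :=
    Finset.sum_congr rfl fun k hk => if_pos hk
  have hsum : (N : ℝ≥0∞) ≤ n 0 + ENNReal.ofReal (N / 4) + ENNReal.ofReal (N / 4) := by
    calc (N : ℝ≥0∞) = ∑' k, n k := (Ψ.tsum_cellOccupation_planeWaveMode hL).symm
      _ ≤ ∑' k, ((if k = 0 then n k else 0) +
          (if k ∈ S then ENNReal.ofReal (Cir / ‖(fun i => (k i : ℝ))‖ ^ 2) else 0) +
            D⁻¹ * (fracDispersion 2 L k * n k)) := ENNReal.tsum_le_tsum hpt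
      _ = n 0 + ∑ k ∈ S, ENNReal.ofReal (Cir / ‖(fun i => (k i : ℝ))‖ ^ 2) +
          D⁻¹ * ∑' k, fracDispersion 2 L k * n k := by
          rw [ENNReal.tsum_add, ENNReal.tsum_add, tsum_ite_eq 0 n, ENNReal.tsum_mul_left,
            tsum_eq_sum (s := S) fun k hk => if_neg hk, hS']
      _ ≤ n 0 + ENNReal.ofReal (N / 4) + ENNReal.ofReal (N / 4) := by gcongr
  -- conclusion: `N/2 + N/2 ≤ n₀ + N/2`
  have h2 : ENNReal.ofReal (1 / 2 * N) + ENNReal.ofReal (1 / 2 * N) = (N : ℝ≥0∞) := by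
    rw [← ENNReal.ofReal_add (by positivity) (by positivity), ← ENNReal.ofReal_natCast]
    exact congrArg ENNReal.ofReal (by ring)
  have h4 : ENNReal.ofReal ((N : ℝ) / 4) + ENNReal.ofReal ((N : ℝ) / 4) =
      ENNReal.ofReal (1 / 2 * N) := by
    rw [← ENNReal.ofReal_add (by positivity) (by positivity)]
    exact congrArg ENNReal.ofReal (by ring)
  have hhalf : ENNReal.ofReal (1 / 2 * N) + ENNReal.ofReal (1 / 2 * N) ≤
      n 0 + ENNReal.ofReal (1 / 2 * N) := by
    rw [h2, ← h4, ← add_assoc]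
    exact hsum
  have h0 : n 0 = condensateOccupation N L Ψ.ψ := cellOccupation_planeWaveMode_zero N L Ψ.ψ
  rw [← h0]
  exact ENNReal.le_of_add_le_add_right ENNReal.ofReal_ne_top hhalf

/-- **The infrared hypothesis of the counting step from the `L¹` bound on the kinetic coherence**:
if `‖G_Ψ‖_{L¹(cell)} ≤ B` then `n_k ≤ (B/(4π²L))/‖k‖_∞²` for every `k ≠ 0`
(`L³ · 4π²‖k‖_∞²/L² · n_k ≤ L³|2πk/L|² n_k ≤ ‖G_Ψ‖₁`). [cite: KLS1988PRL] -/
theorem cellOccupation_le_of_kineticCoherence_le {N : ℕ} {L B : ℝ} (hL : 0 < L)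
    (Ψ : PeriodicTrialState N L)
    (hG : ∫⁻ r in cell L, (‖∑ i : Fin N, ∑ k : Fin 3, ∫ X in cellN N L,
        fderiv ℝ Ψ.ψ (X + Pi.single i r) (Pi.single i (EuclideanSpace.single k (1 : ℝ))) *
          (starRingEnd ℂ) (fderiv ℝ Ψ.ψ X (Pi.single i (EuclideanSpace.single k (1 : ℝ))))‖₊ :
            ℝ≥0∞) ≤ ENNReal.ofReal B)
    (k : Fin 3 → ℤ) (hk : k ≠ 0) :
    cellOccupation N L (planeWaveMode L k) Ψ.ψ ≤
      ENNReal.ofReal (B / (4 * Real.pi ^ 2 * L) / ‖(fun i => (k i : ℝ))‖ ^ 2) := by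
  have hν : 0 < ‖(fun i => (k i : ℝ))‖ := by
    refine norm_pos_iff.2 fun h => hk (funext fun j => ?_)
    have := congrFun h j
    simpa using this
  have h1 := (ir_bound_of_kineticCoherence hL Ψ k).trans hG
  have hpos : 0 < L ^ 3 * (4 * Real.pi ^ 2 * ‖(fun i => (k i : ℝ))‖ ^ 2 / L ^ 2) := by positivity
  have hmul : ENNReal.ofReal (L ^ 3 * (4 * Real.pi ^ 2 * ‖(fun i => (k i : ℝ))‖ ^ 2 / L ^ 2)) ≤
      ENNReal.ofReal L ^ 3 * fracDispersion 2 L k := by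
    rw [fracDispersion_two, ← ENNReal.ofReal_pow hL.le, ← ENNReal.ofReal_mul (by positivity)]
    refine ENNReal.ofReal_le_ofReal ?_
    gcongr
    exact norm_sq_le_sum_sq k
  have hne0 : ENNReal.ofReal L ^ 3 * fracDispersion 2 L k ≠ 0 :=
    ne_of_gt (lt_of_lt_of_le (ENNReal.ofReal_pos.2 hpos) hmul)
  have hnetop : ENNReal.ofReal L ^ 3 * fracDispersion 2 L k ≠ ⊤ :=
    ENNReal.mul_ne_top (ENNReal.pow_ne_top ENNReal.ofReal_ne_top) (fracDispersion_ne_top 2 L k)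
  calc cellOccupation N L (planeWaveMode L k) Ψ.ψ
      ≤ ENNReal.ofReal B / (ENNReal.ofReal L ^ 3 * fracDispersion 2 L k) := by
        rw [ENNReal.le_div_iff_mul_le (Or.inl hne0) (Or.inl hnetop)]
        calc cellOccupation N L (planeWaveMode L k) Ψ.ψ *
              (ENNReal.ofReal L ^ 3 * fracDispersion 2 L k)
            = ENNReal.ofReal L ^ 3 * fracDispersion 2 L k *
                cellOccupation N L (planeWaveMode L k) Ψ.ψ := by ring
          _ ≤ ENNReal.ofReal B := h1
    _ ≤ ENNReal.ofReal B /
          ENNReal.ofReal (L ^ 3 * (4 * Real.pi ^ 2 * ‖(fun i => (k i : ℝ))‖ ^ 2 / L ^ 2)) :=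
        ENNReal.div_le_div_left hmul _
    _ = ENNReal.ofReal (B / (L ^ 3 * (4 * Real.pi ^ 2 * ‖(fun i => (k i : ℝ))‖ ^ 2 / L ^ 2))) :=
        (ENNReal.ofReal_div_of_pos hpos).symm
    _ = ENNReal.ofReal (B / (4 * Real.pi ^ 2 * L) / ‖(fun i => (k i : ℝ))‖ ^ 2) := by
        congr 1
        field_simp

end LaplacianModeCounting

/-! ## §7 The route item -/

open Literature.MathematicalPhysics.QuantumManyBody.BoseGas
open Summit.AtomisticToContinuum.BoseEinsteinCondensation.Theses.BECLaplacianL1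
open LaplacianModeCounting ModeCounting

/-- **Mode counting from `L¹` clustering of the kinetic coherence** (route BECLaplacianL1, item
`ModeCountingL1`, stmt-AtomisticToContinuum-9012). For every repulsive finite-range `v`: if for
every `ε > 0` the `δ`-near-minimisers of the periodic energy on the torus of side
`L_N = (N/ρ)^{1/3}` have kinetic coherence of `L¹` norm `≤ ε N ρ^{-1/3}` (all small `ρ`, eventually
in `N`), and `E₀^per ≤ C ρ^{2/3} N`, then the same near-minimisers condense, `⟨Ψ, n₀Ψ⟩ ≥ N/2`.
Proof: with `s = ρ^{1/3}`, `κ = √(C+1)/π`, `ε = π²/(26κ)` and slack `δ ≤ s²N`: the infrared bound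
`n_k ≤ εN/(4π²sL‖k‖_∞²)` (`ir_bound_of_kineticCoherence`) on `0 < ‖k‖_∞ ≤ κsL` carries `≤ N/4`
particles by the shell sum `∑ 1/‖k‖_∞² ≤ 26M`; the tail `‖k‖_∞ > κsL` carries
`≤ (E₀ + δ)/(4π²κ²s²) ≤ (C+1)s²N/(4(C+1)s²) = N/4`; Parseval gives `n₀ ≥ N/2`.
[cite: LSSY2005, §1.2 (1.17)–(1.19)] -/
theorem modeCountingL1_proof : ModeCountingL1 := by
  intro v _hv hX hE
  obtain ⟨C, hC, ρE, hρE, hEv⟩ := hE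
  -- constants
  set κ : ℝ := Real.sqrt (C + 1) / Real.pi with hκ
  have hκ0 : 0 < κ := by positivity
  have hκ2 : Real.pi ^ 2 * κ ^ 2 = C + 1 := by
    rw [hκ, div_pow, Real.sq_sqrt (by positivity)]
    field_simp
  set ε : ℝ := Real.pi ^ 2 / (26 * κ) with hε
  have hε0 : 0 < ε := by positivity
  obtain ⟨ρX, hρX, hXv⟩ := hX ε hε0
  refine ⟨min ρX ρE, lt_min hρX hρE, fun ρ hρ hρ₀ => ?_⟩
  have hρX' : ρ < ρX := lt_of_lt_of_le hρ₀ (min_le_left _ _)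
  have hρE' : ρ < ρE := lt_of_lt_of_le hρ₀ (min_le_right _ _)
  -- `s = ρ^{1/3}`
  set s : ℝ := ρ ^ ((1 : ℝ) / 3) with hs
  have hs0 : 0 < s := Real.rpow_pos_of_pos hρ _
  have hs2 : ρ ^ ((2 : ℝ) / 3) = s ^ 2 := by
    rw [hs, show ((2 : ℝ) / 3) = (1 : ℝ) / 3 * 2 by norm_num, Real.rpow_mul hρ.le, Real.rpow_two]
  have hsinv : ρ ^ (-(1 : ℝ) / 3) = s⁻¹ := by
    rw [hs, neg_div, Real.rpow_neg hρ.le]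
  -- the answer: `c = 1/2`, eventually in `N`
  refine ⟨1 / 2, by norm_num, ?_⟩
  filter_upwards [hXv ρ hρ hρX', hEv ρ hρ hρE', eventually_ge_atTop 1] with N ⟨δX, hδX, hXN⟩ hEN hN1
  have hNr : (0 : ℝ) < N := Nat.cast_pos.2 hN1
  set L : ℝ := sideLength ρ N with hLdef
  have hL : 0 < L := Real.rpow_pos_of_pos (div_pos hNr hρ) _
  -- the slack `δ_N = min(δ_X, s²N)`
  refine ⟨min δX (ENNReal.ofReal (s ^ 2 * N)),
    lt_min hδX (ENNReal.ofReal_pos.2 (by positivity)), ?_⟩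
  intro Ψ hΨ
  have hΨX : periodicEnergy v Ψ ≤ periodicGroundStateEnergy v N L + δX :=
    hΨ.trans (add_le_add le_rfl (min_le_left _ _))
  have hΨE : periodicEnergy v Ψ ≤ ENNReal.ofReal ((C + 1) * s ^ 2 * N) := by
    calc periodicEnergy v Ψ ≤ periodicGroundStateEnergy v N L + ENNReal.ofReal (s ^ 2 * N) :=
          hΨ.trans (add_le_add le_rfl (min_le_right _ _))
      _ ≤ ENNReal.ofReal (C * ρ ^ ((2 : ℝ) / 3) * N) + ENNReal.ofReal (s ^ 2 * N) :=
          add_le_add hEN le_rfl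
      _ = ENNReal.ofReal ((C + 1) * s ^ 2 * N) := by
          rw [hs2, ← ENNReal.ofReal_add (by positivity) (by positivity)]
          exact congrArg ENNReal.ofReal (by ring)
  -- the clustering bound on the kinetic coherence
  have hGN := hXN Ψ hΨX
  rw [hsinv] at hGN
  -- the counting step with `K = κ s L`, `C_ir = εN/(4π² s L)`, `D = 4π²κ²s²`
  set D : ℝ≥0∞ := ENNReal.ofReal (4 * Real.pi ^ 2 * κ ^ 2 * s ^ 2) with hD
  have hDpos : 0 < 4 * Real.pi ^ 2 * κ ^ 2 * s ^ 2 := by positivity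
  have hD0 : D ≠ 0 := (ENNReal.ofReal_pos.2 hDpos).ne'
  refine condensate_ge_half_sq hL (K := κ * s * L) (Cir := ε * N * s⁻¹ / (4 * Real.pi ^ 2 * L))
    (by positivity) (by positivity) v Ψ hD0 ENNReal.ofReal_ne_top ?_ ?_ ?_ ?_
  · -- (IR) from the `L¹` bound on the kinetic coherence
    intro k hk0 _hkK
    exact cellOccupation_le_of_kineticCoherence_le hL Ψ hGN k hk0
  · -- (UV) `4π²κ²s² ≤ |2πk/L|²` off the window (`‖k‖_∞² ≤ |k|₂²`)
    intro k hk
    rw [hD, fracDispersion_two]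
    refine ENNReal.ofReal_le_ofReal ?_
    have h1 : (κ * s * L) ^ 2 < ∑ j, (k j : ℝ) ^ 2 := by
      calc (κ * s * L) ^ 2 < ‖(fun i => (k i : ℝ))‖ ^ 2 := by gcongr
        _ ≤ ∑ j, (k j : ℝ) ^ 2 := norm_sq_le_sum_sq k
    rw [mul_pow, mul_pow] at h1
    rw [le_div_iff₀ (by positivity)]
    calc 4 * Real.pi ^ 2 * κ ^ 2 * s ^ 2 * L ^ 2 = 4 * Real.pi ^ 2 * (κ ^ 2 * s ^ 2 * L ^ 2) := by
          ring
      _ ≤ 4 * Real.pi ^ 2 * ∑ j, (k j : ℝ) ^ 2 := by gcongr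
  · -- (T) `(E₀ + δ)/(4π²κ²s²) ≤ (C+1)s²N/(4(C+1)s²) = N/4`
    calc D⁻¹ * periodicEnergy v Ψ ≤ D⁻¹ * ENNReal.ofReal ((C + 1) * s ^ 2 * N) := by gcongr
      _ = ENNReal.ofReal ((C + 1) * s ^ 2 * N / (4 * Real.pi ^ 2 * κ ^ 2 * s ^ 2)) := by
          rw [← ENNReal.div_eq_inv_mul, hD, ← ENNReal.ofReal_div_of_pos hDpos]
      _ = ENNReal.ofReal (N / 4) := by
          congr 1
          rw [show 4 * Real.pi ^ 2 * κ ^ 2 * s ^ 2 = 4 * (Real.pi ^ 2 * κ ^ 2) * s ^ 2 by ring, hκ2]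
          field_simp
  · -- (window) `εN/(4π²sL) · 26 κ s L = 26εκN/(4π²) = N/4`
    refine le_of_eq ?_
    rw [hε]
    field_simp

end Summit.AtomisticToContinuum.BoseEinsteinCondensation.Theorems

end
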